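/-
Copyright (c) 2026. Released under the Apache 2.0 license.
-/
import Literature.NumberTheory.EllipticCurves.ManinConstantQuadraticTwistCremonaRangeProofs
import HarnessLib

/-!
# The class Manin certificate DESCENDS along a semistable quadratic twist:
# `ClassAbsManinConstantEqOne (𝒜') → ClassAbsManinConstantEqOne (𝒜)` for `𝒜 = 𝒜' ⊗ χ_{q*}`,
# `𝒜'` semistable at the odd prime `q` — the bound-free core of the twist-descent roads

[Proofs] Theorems only (no definition, no named fact; D-0026). Topic
`Literature/NumberTheory/EllipticCurves`; namespace `Literature.NumberTheory.EllipticCurves.ModularForms`.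

The twist-descent roads of `ManinConstantQuadraticTwistCremonaRangeProofs.lean` (partner level
`≤ 130000`, Agashe–Ribet–Stein 2006 Thm. 2.6 = `h26`) and
`ManinConstantQuadraticTwistLevelBoundProofs.lean` / `…CremonaDeterminedRangeProofs.lean` (generic
bound `B`; `B = 400000`, Cremona's determined range = `h40`) all end the same way: the `Γ₀` twist
step `c₀(𝒜) ∣ c(D')` (`maninConstant_dvd_of_charTwist_gamma0`; Stevens 1989 Lemmas (5.2), (5.4))
for the optimal `X₀`-datum `D'` of the PARTNER class `𝒜'`, followed by SOME source of `|c(D')| = 1`.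
This file isolates the step from the source: the hypothesis is the tree's CLASS PREDICATE
`ClassAbsManinConstantEqOne` (`ManinConstantClassCertificate.lean`: "`|c| = 1` for every
lattice-optimal `X₀`-datum of every globally minimal member of the class") AT THE PARTNER, and the
conclusion is the same predicate at the twisted class — with NO level bound and NO Manin datum:

* `classAbsManinConstantEqOne_of_isTwistOf` — `W ∼ W' ⊗ χ_{q*}` (`W'` globally minimal,
  `N(W') ∣ N(W)`, `q² ∣ N(W)`, `q² ∤ N(W')`, `W` additive at `q`) and
  `ClassAbsManinConstantEqOne W'` ⟹ `ClassAbsManinConstantEqOne W`. Binder `hnf` (modularity, to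
  produce the partner's optimal datum and identify levels with conductors) ONLY.
* `classAbsManinConstantEqOne_of_quadraticTwist_pStar` — no witness: `q² ∣ N(W)` and the twist
  `Q = W ⊗ χ_{q*}` good or multiplicative at `q`; hypothesis `ClassAbsManinConstantEqOne Q`.
* Kodaira front-ends `classAbsManinConstantEqOne_of_kodairaSymbolAt_eq_Istar_zero/_succ/…`
  (`W` globally minimal of Kodaira type `Iₙ*` at the odd `q`; hypothesis
  `ClassAbsManinConstantEqOne (W ⊗ χ_{q*})`).
* `classAbsManinConstantEqOne_of_kodairaSymbolAt_eq_Istar_of_optimalCurveManinCertificate` — the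
  same with the partner's certificate supplied as ONE ROW `OptimalCurveManinCertificate V`
  (`ManinConstantClassCertificate.lean`: "`V` is the optimal curve of its class and that class has
  `|c| = 1`" — the shape of a two-implementation full-space modular-symbol certificate at the
  partner's level, Agashe–Ribet–Stein 2006 appendix §5) for any `V` isogenous to the twist.

So every SOURCE of the partner's certificate — the printed range theorem (`h26`,
`classAbsManinConstantEqOne_of_conductorNorm_le`), a squarefree partner conductor (Česnavičius 2018,
`classAbsManinConstantEqOne_of_squarefree_conductorNorm`), Cremona's determined range (`h40`), or a
per-class two-engine certificate at the PARTNER's level (`N(W)/q²` or `N(W)/q`, a far smaller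
modular-symbol space than at `N(W)`) — transports to the twisted class by ONE theorem. The proofs
are those of the level-bounded files with the last line changed (the datum `hB W₁' D' hopt' hlev`
becomes `hV W₁' D' hiso' hopt'`). `q = 2` is not treated (Stevens' `η`).

## References
* [Stevens1989] G. Stevens, *Stickelberger elements and modular parametrizations of elliptic
  curves*, Invent. Math. 98 (1989) 75–106: Lemma (5.2) p. 96, Lemma (5.4) p. 97.
* [AgasheRibetStein2006] A. Agashe, K. Ribet, W. A. Stein, *The Manin constant*, with an appendix
  by J. Cremona, Pure Appl. Math. Q. 2 (2006) 617–636: §2, Thm. 2.6, appendix §5.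
* [EdixhovenManin1991] B. Edixhoven, Progr. Math. 89 (1991), §1 (typescript L96–101: the
  Mazur–Stevens twist deduction) and Prop. 2.
* [SilvermanATAEC1994] J. H. Silverman, *ATAEC*, IV.10.2, IV.10.4, IV.11.1 (table p. 368), Cor.
  IV.9.1.
* [CremonaAlgorithms1997] J. E. Cremona, *Algorithms for Modular Elliptic Curves*, 2nd ed., §3.9.
-/

noncomputable section

open scoped MatrixGroups ModularForm Classical

open CongruenceSubgroup WeierstrassCurve IsDedekindDomain IsDedekindDomain.HeightOneSpectrum
  NumberField Rat.HeightOneSpectrum Literature.NumberTheory.Automorphic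

namespace Literature.NumberTheory.EllipticCurves.ModularForms

/-! ### Elementary bookkeeping -/

section Elementary

variable {q : ℕ}

/-- The place of `ℤ` under `q` has generator `q`. [folklore] -/
private theorem natGenerator_place'' (hq : q.Prime) :
    natGenerator ((primesEquiv (R := ℤ)).symm ⟨q, hq⟩) = q :=
  Literature.NumberTheory.EllipticCurves.Rat.natGenerator_primesEquiv_symm ⟨q, hq⟩

/-- `ord_q(q*) = 1` at the place of `ℤ` under `q`. [folklore] -/
private theorem valuation_pStar'' (hq : q.Prime) :
    ((primesEquiv (R := ℤ)).symm ⟨q, hq⟩).valuation ℚ ((((-1 : ℤ) ^ (q / 2) * q : ℤ)) : ℚ) =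
      WithZero.exp (-1 : ℤ) := by
  set v : HeightOneSpectrum ℤ := (primesEquiv (R := ℤ)).symm ⟨q, hq⟩ with hv
  have hgen : natGenerator v = q := natGenerator_place'' hq
  have hunit : v.valuation ℚ (((-1 : ℤ) ^ (q / 2) : ℤ) : ℚ) = 1 := by
    rw [Literature.NumberTheory.EllipticCurves.Rat.valuation_intCast_eq_one_iff, hgen]
    intro h
    have hu : IsUnit ((-1 : ℤ) ^ (q / 2)) := (isUnit_neg_one (α := ℤ)).pow _
    have h1 : (q : ℤ) ∣ 1 := h.trans (isUnit_iff_dvd_one.mp hu)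
    exact hq.one_lt.ne' (by exact_mod_cast Int.eq_one_of_dvd_one (by positivity) h1)
  have hqv : v.valuation ℚ (q : ℚ) = WithZero.exp (-1 : ℤ) := by
    rw [← hgen]; exact Rat.HeightOneSpectrum.valuation_natGenerator_int v
  push_cast
  rw [map_mul, hqv]
  have : v.valuation ℚ ((-1 : ℚ) ^ (q / 2)) = 1 := by
    have h := hunit; push_cast at h; exact h
  rw [this, one_mul]

end Elementary

/-! ### The transport theorem with a displayed isogenous witness -/

section Witness

variable {W : WeierstrassCurve ℚ} [W.IsElliptic]
  {W' : WeierstrassCurve ℚ} [W'.IsElliptic] [W'.IsGloballyMinimal]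

/-- **The class Manin certificate descends along a semistable quadratic twist.** Hypotheses:
`W ∈ 𝒜` (any model), `W' ∈ 𝒜'` globally minimal, `W ∼ W'.quadraticTwist q*` for an odd prime `q`;
`N(W') ∣ N(W)`, `q² ∣ N(W)`, `q² ∤ N(W')`; `W` additive at `q`; and the class predicate at the
partner, `ClassAbsManinConstantEqOne W'`. Conclusion: `ClassAbsManinConstantEqOne W`. Proof: for a
globally minimal `W₀ ∼ W` with a lattice-optimal `X₀`-datum `D₀`, the optimal `X₀`-datum `D'` of `𝒜'`
exists by modularity (`exists_optimal_modularParametrizationData_of_isNewformOf'`, lattice-optimal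
by `latticeEq_of_forall_modularDegree_le`) on a globally minimal `W₁' ∼ W'` with `N(W₁') = N(W')`,
hence semistable at `q`; `aₙ(f_{D₀}) = (n/q)·aₙ(f_{D'})`; Stevens (5.2) (the tree THEOREM
`stevens1989_neronLattice_quadraticTwist_oddPrime_holds`) gives the Néron lattice of the minimal
model of `W₁' ⊗ χ_{q*}`; the twist step `maninConstant_dvd_of_charTwist_gamma0` gives
`D₀.c ∣ D'.c`; and `|D'.c| = 1` is the partner's class predicate applied to `(W₁', D')`.
Binder `hnf` only; NO level bound, NO Manin datum.
[cite: Stevens1989, Lemmas (5.2), (5.4)] [cite: EdixhovenManin1991, §1]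
[cite: AgasheRibetStein2006, §2] -/
theorem classAbsManinConstantEqOne_of_isTwistOf
    (hnf : exists_isNewformOf)
    {q : ℕ} [Fact q.Prime] (hq2 : q ≠ 2)
    (htw : IsIsogenous W (W'.quadraticTwist (((-1 : ℤ) ^ (q / 2) * q : ℤ) : ℚ)))
    (hN'N : W'.conductorNorm ℤ ∣ W.conductorNorm ℤ) (hqN : q ^ 2 ∣ W.conductorNorm ℤ)
    (hqN' : ¬ q ^ 2 ∣ W'.conductorNorm ℤ)
    (hadd : ¬ W.HasGoodReductionAtPrime q ∧ ¬ W.HasMultiplicativeReductionAtPrime q)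
    (hV : ClassAbsManinConstantEqOne W') :
    ClassAbsManinConstantEqOne W := by
  intro W₀ _ _ N₀ _ D₀ hiso h₀
  have hqp : q.Prime := Fact.out
  have hd0 : ((((-1 : ℤ) ^ (q / 2) * q : ℤ)) : ℚ) ≠ 0 := by
    push_cast
    exact mul_ne_zero (pow_ne_zero _ (by norm_num)) (by exact_mod_cast hqp.ne_zero)
  -- the levels are the conductors
  have hLW₀ : W.LFunction = W₀.LFunction := LFunction_eq_of_isIsogenous_holds W W₀ hiso
  have hnfW : IsNewformOf W D₀.f :=
    ⟨D₀.isNewformOf.1, fun n ↦ by rw [D₀.isNewformOf.2 n, hLW₀]⟩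
  have hN₀ : N₀ = W.conductorNorm ℤ :=
    IsNewformOf.level_eq_conductorNorm_of_exists_isNewformOf hnf hnfW
  haveI : NeZero (W'.conductorNorm ℤ) := ⟨(conductorNorm_pos_holds W').ne'⟩
  -- the optimal `X₀`-datum `D'` of `𝒜'`, on a globally minimal `W₁' ∼ W'`
  obtain ⟨f', hf'⟩ := hnf W'
  obtain ⟨W₁', hE₁', hM₁', D', hD'f, hiso', hmin⟩ :=
    exists_optimal_modularParametrizationData_of_isNewformOf' (W'.conductorNorm ℤ) W' rfl hf'
  haveI := hE₁'
  haveI := hM₁'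
  have hopt' : ∀ z ∈ D'.L.lattice, ∃ w ∈ periodLattice D'.f, z = D'.c * w :=
    D'.latticeEq_of_forall_modularDegree_le fun W₂ _ D₂ h2 ↦ hmin W₂ D₂ (h2.trans hD'f)
  -- `W₁'` is semistable at `q`: its conductor is the level `N(W')`, and `q² ∤ N(W')`
  have hN'₁ : W'.conductorNorm ℤ = W₁'.conductorNorm ℤ :=
    IsNewformOf.level_eq_conductorNorm_of_exists_isNewformOf hnf D'.isNewformOf
  have hsemi : W₁'.HasGoodReductionAtPrime q ∨ W₁'.HasMultiplicativeReductionAtPrime q :=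
    hasGoodReductionAtPrime_or_hasMultiplicativeReductionAtPrime_of_not_sq_dvd_conductorNorm
      (by rw [← hN'₁]; exact hqN')
  -- the minimal model `C` of `W₁' ⊗ χ_{q*}` and a Néron pair of it
  haveI : (W₁'.quadraticTwist (((-1 : ℤ) ^ (q / 2) * q : ℤ) : ℚ)).IsElliptic :=
    W₁'.isElliptic_quadraticTwist hd0
  obtain ⟨vC, hvC⟩ := hasGlobalMinimalModel_rat_holds
    (W₁'.quadraticTwist (((-1 : ℤ) ^ (q / 2) * q : ℤ) : ℚ))
  haveI := hvC
  haveI : ((vC • W₁'.quadraticTwist (((-1 : ℤ) ^ (q / 2) * q : ℤ) : ℚ)).baseChange ℂ).IsElliptic := by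
    rw [WeierstrassCurve.baseChange]; infer_instance
  obtain ⟨LC, hC⟩ := exists_isNeronLatticeOf_holds
    ((vC • W₁'.quadraticTwist (((-1 : ℤ) ^ (q / 2) * q : ℤ) : ℚ)).baseChange ℂ)
  -- the Legendre character and Gauss's evaluation
  have hχq := isQuadratic_quadraticChar_ringHomComp q
  have hχp := isPrimitive_quadraticChar_ringHomComp q hq2
  have hG := gaussSum_quadraticChar_ringHomComp_sq q hq2
  -- the newform of `𝒜` is the `(·/q)`-twist of that of `𝒜'`
  have hLtw : W.LFunction =
      (W'.quadraticTwist (((-1 : ℤ) ^ (q / 2) * q : ℤ) : ℚ)).LFunction := by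
    haveI : (W'.quadraticTwist (((-1 : ℤ) ^ (q / 2) * q : ℤ) : ℚ)).IsElliptic :=
      W'.isElliptic_quadraticTwist hd0
    exact LFunction_eq_of_isIsogenous_holds _ _ htw
  have hf : ∀ n : ℕ, cuspCoeff D₀.f n =
      (quadraticChar (ZMod q)).ringHomComp (Int.castRingHom ℂ) n * cuspCoeff D'.f n := by
    intro n
    have hLn : W₀.LFunction n = W.LFunction n := by rw [hLW₀]
    rw [D₀.isNewformOf.2 n, hD'f, hf'.2 n, hLn, quadraticChar_ringHomComp_apply_natCast q n]
    by_cases hqn : q ∣ n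
    · have h0 : W.LFunction n = 0 :=
        W.LFunction_apply_eq_zero_of_not_good_of_not_mult q hadd.1 hadd.2 hqn
      have hl : legendreSym q n = 0 := (legendreSym.eq_zero_iff q n).mpr (by
        rw [ZMod.intCast_zmod_eq_zero_iff_dvd]
        exact_mod_cast hqn)
      rw [h0, hl]
      simp
    · have hLn' : W.LFunction n =
          (W'.quadraticTwist (((-1 : ℤ) ^ (q / 2) * q : ℤ) : ℚ)).LFunction n := by rw [hLtw]
      rw [hLn', W'.LFunction_quadraticTwist_pStar_apply hq2 hqn]
      have hne : ((n : ℤ) : ZMod q) ≠ 0 := by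
        rw [Int.cast_natCast, Ne, ZMod.natCast_eq_zero_iff]
        exact hqn
      push_cast
      rcases legendreSym.eq_one_or_neg_one q hne with h1 | h1
      · rw [show (legendreSym q (n : ℤ)) = legendreSym q n from rfl, h1]
      · rw [show (legendreSym q (n : ℤ)) = legendreSym q n from rfl, h1]
  -- conductor bookkeeping at level `N₀ = N(W)`
  have hN : W'.conductorNorm ℤ ∣ N₀ := by rw [hN₀]; exact hN'N
  have hm : q ^ 2 ∣ N₀ := by rw [hN₀]; exact hqN
  -- Stevens (5.2), PROVED: the Néron lattice of `C` is `g(χ)⁻¹ Λ(D')`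
  have hLC : ∀ z : ℂ, z ∈ LC.lattice ↔
      gaussSum ((quadraticChar (ZMod q)).ringHomComp (Int.castRingHom ℂ))
        (ZMod.stdAddChar (N := q)) * z ∈ D'.L.lattice :=
    stevens1989_neronLattice_quadraticTwist_oddPrime_holds W₁' D'.L D'.isNeronLattice q hq2 hsemi
      (vC • W₁'.quadraticTwist (((-1 : ℤ) ^ (q / 2) * q : ℤ) : ℚ)) ⟨vC, rfl⟩ LC hC _ hG
  -- the twist step on `Γ₀`: `c(D₀) ∣ c(D')`
  have hdvd : D₀.c ∣ D'.c :=
    maninConstant_dvd_of_charTwist_gamma0 D' D₀ h₀ hχq hχp hN hm hf hC hLC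
  -- the partner's class predicate at `(W₁', D')`
  have h1 : |D'.maninConstant| = 1 := hV W₁' D' hiso' hopt'
  exact Int.isUnit_iff_abs_eq.mp (isUnit_of_dvd_unit hdvd (Int.isUnit_iff_abs_eq.mpr h1))

/-- From the tree's displayed witness `TwistSemistableWitnessAt W' q`
(`ManinConstantClassCertificateTwist.lean`; its torsion clause is not used): the certificate of the
witness's class transports to the class of `W'`. [cite: Stevens1989, Lemmas (5.2), (5.4)]
[cite: EdixhovenManin1991, §1] -/
theorem classAbsManinConstantEqOne_of_twistSemistableWitnessAt_of_classAbsManinConstantEqOne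
    (hnf : exists_isNewformOf)
    (W₂ : WeierstrassCurve ℚ) [W₂.IsElliptic] [W₂.IsGloballyMinimal]
    {q : ℕ} [Fact q.Prime] (htw : TwistSemistableWitnessAt W₂ q)
    (hV : ∀ (V : WeierstrassCurve ℚ) [V.IsElliptic] [V.IsGloballyMinimal],
      IsIsogenous W₂ (V.quadraticTwist (((-1 : ℤ) ^ (q / 2) * q : ℤ) : ℚ)) →
      V.conductorNorm ℤ * q ∣ W₂.conductorNorm ℤ → ClassAbsManinConstantEqOne V) :
    ClassAbsManinConstantEqOne W₂ := by
  obtain ⟨hq2, V, hVE, hVM, hiso, hdvd, hdvdq, hsq, hadd, -⟩ := htw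
  haveI := hVE
  haveI := hVM
  exact classAbsManinConstantEqOne_of_isTwistOf hnf hq2 hiso hdvd
    (sq_dvd_conductorNorm_of_not_good_of_not_mult hadd) hsq hadd (hV V hiso hdvdq)

end Witness

/-! ### No witness: the twist of `W` itself is semistable at `q` -/

section Semistable

variable {W : WeierstrassCurve ℚ} [W.IsElliptic]

/-- **`ClassAbsManinConstantEqOne (W ⊗ χ_{q*}) → ClassAbsManinConstantEqOne W` when `q² ∣ N(W)`
and the twist `Q = W ⊗ χ_{q*}` is good or multiplicative at the odd prime `q`.** Inside (as in
`abs_maninConstant_eq_one_of_quadraticTwist_pStar_of_level_le`): the global minimal model `A` of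
`Q` is semistable at `q`, `f_q(A) ≤ 1 < 2 ≤ f_q(W)`, `f_ℓ(A) = f_ℓ(W)` for `ℓ ≠ q`
(`conductorExponent_twistModel`), whence `N(A) ∣ N(W)` and `q² ∤ N(A)`;
`W ≅ W^{(q*·q*)} = Q^{(q*)} ∼ A^{(q*)}`; the predicate passes from `Q` to `A` by class invariance
(`ClassAbsManinConstantEqOne.of_isIsogenous`); then `classAbsManinConstantEqOne_of_isTwistOf`.
Binder `hnf` only. [cite: Stevens1989, Lemmas (5.2), (5.4)]
[cite: SilvermanATAEC1994, IV.10.2 and IV.10.4] [cite: CremonaAlgorithms1997, §3.9] -/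
theorem classAbsManinConstantEqOne_of_quadraticTwist_pStar
    (hnf : exists_isNewformOf)
    {q : ℕ} (hq : q.Prime) (hq2 : q ≠ 2) (hsq : q ^ 2 ∣ W.conductorNorm ℤ)
    (hsemi :
      (W.quadraticTwist (((-1 : ℤ) ^ (q / 2) * q : ℤ) : ℚ)).HasGoodReductionAt
          ((primesEquiv (R := ℤ)).symm ⟨q, hq⟩) ∨
      (W.quadraticTwist (((-1 : ℤ) ^ (q / 2) * q : ℤ) : ℚ)).HasMultiplicativeReductionAt
          ((primesEquiv (R := ℤ)).symm ⟨q, hq⟩))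
    (hQ : @ClassAbsManinConstantEqOne (W.quadraticTwist (((-1 : ℤ) ^ (q / 2) * q : ℤ) : ℚ))) :
    ClassAbsManinConstantEqOne W := by
  haveI := Fact.mk hq
  set d : ℤ := (-1 : ℤ) ^ (q / 2) * q with hd
  set k : ℤ := (d - 1) / 4 with hk
  have h4k : (4 : ℤ) * k + 1 = d := by
    have h4 := four_dvd_pStar_sub_one (p := q) hq2
    have := Int.ediv_mul_cancel h4
    rw [hk]; linarith [this]
  have h4kℚ : (4 : ℚ) * (k : ℚ) + 1 = (d : ℚ) := by exact_mod_cast h4k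
  have hdZ : d ≠ 0 := mul_ne_zero (pow_ne_zero _ (by norm_num)) (by exact_mod_cast hq.ne_zero)
  have hd0 : (d : ℚ) ≠ 0 := by exact_mod_cast hdZ
  set vq : HeightOneSpectrum ℤ := (primesEquiv (R := ℤ)).symm ⟨q, hq⟩ with hvq
  set N : ℕ := W.conductorNorm ℤ with hN
  have hN0 : N ≠ 0 := (conductorNorm_pos_holds W).ne'
  -- `f_q(W) ≥ 2`: `W` is additive at `q`
  have hfW : 2 ≤ W.conductorExponent vq := by
    rw [← factorization_conductorNorm_primesEquiv_symm W ⟨q, hq⟩]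
    exact (hq.pow_dvd_iff_le_factorization hN0).mp hsq
  have hadd : ¬ W.HasGoodReductionAtPrime q ∧ ¬ W.HasMultiplicativeReductionAtPrime q := by
    refine ⟨fun hg ↦ ?_, fun hmu ↦ ?_⟩
    · have h0 : W.conductorExponent vq = 0 := (conductorExponent_eq_zero_iff_holds vq W).mpr
        ((W.hasGoodReductionAtPrime_iff_hasGoodReductionAt_holds ⟨q, hq⟩).mp hg)
      omega
    · have h1 : W.conductorExponent vq = 1 := (conductorExponent_eq_one_iff_holds vq W).mpr
        ((W.hasMultiplicativeReductionAtPrime_iff_hasMultiplicativeReductionAt_holds ⟨q, hq⟩).mp hmu)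
      omega
  -- the twist `Q` and its global minimal model `A`
  set Q : WeierstrassCurve ℚ := W.quadraticTwist (d : ℚ) with hQdef
  haveI hQell : Q.IsElliptic := W.isElliptic_quadraticTwist hd0
  obtain ⟨CA, hA⟩ := hasGlobalMinimalModel_rat_holds Q
  set A : WeierstrassCurve ℚ := CA • Q with hAdef
  haveI : A.IsGloballyMinimal := hA
  have hNA0 : A.conductorNorm ℤ ≠ 0 := (conductorNorm_pos_holds A).ne'
  -- `A` is semistable at `q`
  have hsemiA : A.HasGoodReductionAt vq ∨ A.HasMultiplicativeReductionAt vq := by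
    rcases hsemi with hg | hm
    · exact Or.inl ((hasGoodReductionAt_smul_iff_holds vq Q CA).mpr hg)
    · exact Or.inr ((hasMultiplicativeReductionAt_smul_iff_holds vq Q CA).mpr hm)
  have hfA : A.conductorExponent vq ≤ 1 := by
    rcases hsemiA with hg | hm
    · rw [(conductorExponent_eq_zero_iff_holds vq A).mpr hg]; exact Nat.zero_le 1
    · rw [(conductorExponent_eq_one_iff_holds vq A).mpr hm]
  -- `q² ∤ N(A)`
  have hqNA : ¬ q ^ 2 ∣ A.conductorNorm ℤ := by
    rw [hq.pow_dvd_iff_le_factorization hNA0, factorization_conductorNorm_primesEquiv_symm A ⟨q, hq⟩,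
      ← hvq]
    exact not_le.mpr (lt_of_le_of_lt hfA one_lt_two)
  -- `N(A) ∣ N(W)`, prime by prime
  have hNA : A.conductorNorm ℤ ∣ N := by
    refine conductorNorm_dvd_of_forall_conductorExponent_le A hN0 fun p ↦ ?_
    rw [hN, factorization_conductorNorm_primesEquiv_symm W p]
    by_cases hpq : (p : ℕ) = q
    · have hp' : p = ⟨q, hq⟩ := Subtype.ext hpq
      rw [hp', ← hvq]
      exact hfA.trans ((Nat.le_succ 1).trans hfW)
    · -- unramified place: `f_p(A) = f_p(Q) = f_p(W.twistModel k) = f_p(W)`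
      set v : HeightOneSpectrum ℤ := (primesEquiv (R := ℤ)).symm p with hv
      have hgenp : natGenerator v = p :=
        Literature.NumberTheory.EllipticCurves.Rat.natGenerator_primesEquiv_symm p
      obtain ⟨C₀, -, hC₀⟩ := exists_variableChange_twistModel_eq_quadraticTwist W (k : ℚ)
      rw [h4kℚ] at hC₀
      haveI hTell : (W.twistModel (k : ℚ)).IsElliptic := by
        have h : W.twistModel (k : ℚ) = C₀⁻¹ • Q := by
          rw [hQdef, ← hC₀, ← mul_smul, inv_mul_cancel, one_smul]
        rw [h]; infer_instance
      have hkv : v.valuation ℚ (k : ℚ) ≤ 1 := by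
        rw [show (k : ℚ) = algebraMap ℤ ℚ k from (eq_intCast _ k).symm]
        exact HeightOneSpectrum.valuation_le_one v k
      have hdv : v.valuation ℚ (4 * (k : ℚ) + 1) = 1 := by
        rw [h4kℚ, Literature.NumberTheory.EllipticCurves.Rat.valuation_intCast_eq_one_iff, hgenp]
        intro h
        have hu : IsUnit ((-1 : ℤ) ^ (q / 2)) := (isUnit_neg_one (α := ℤ)).pow _
        have h' : ((p : ℕ) : ℤ) ∣ (q : ℤ) := (hu.dvd_mul_left).mp h
        exact hpq ((Nat.prime_dvd_prime_iff_eq p.2 hq).mp (Int.natCast_dvd_natCast.mp h'))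
      have h1 : A.conductorExponent v = Q.conductorExponent v := conductorExponent_smul' v Q CA
      have h2 : Q.conductorExponent v = (W.twistModel (k : ℚ)).conductorExponent v := by
        rw [hQdef, ← hC₀, conductorExponent_smul']
      have h3 : (W.twistModel (k : ℚ)).conductorExponent v = W.conductorExponent v :=
        conductorExponent_twistModel v W hkv hdv
      rw [h1, h2, h3]
  -- `W ∼ A ⊗ χ_{q*}`: `W ≅ W^{(1)} ≅ W^{(d·d)} = Q^{(d)} ∼ A^{(d)}`
  have htw : IsIsogenous W (A.quadraticTwist (d : ℚ)) := by
    obtain ⟨C₁, hC₁⟩ := W.exists_variableChange_quadraticTwist_one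
    obtain ⟨C₂, hC₂⟩ := W.exists_variableChange_quadraticTwist_mul_sq (1 : ℚ) (d : ℚ) hd0
    have h12 : IsIsogenous W (W.quadraticTwist ((1 : ℚ) * (d : ℚ) ^ 2)) :=
      IsIsogenous.trans' (isIsogenous_of_smul_eq hC₁) (isIsogenous_of_smul_eq hC₂)
    have hdd : W.quadraticTwist ((1 : ℚ) * (d : ℚ) ^ 2) = Q.quadraticTwist (d : ℚ) := by
      rw [hQdef, quadraticTwist_quadraticTwist]; congr 1; ring
    rw [hdd] at h12
    exact IsIsogenous.trans' h12 ((isIsogenous_smul Q CA).quadraticTwist hd0)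
  -- the partner's predicate passes from `Q` to its minimal model `A` (same class)
  have hV : ClassAbsManinConstantEqOne A := hQ.of_isIsogenous (isIsogenous_smul Q CA)
  exact classAbsManinConstantEqOne_of_isTwistOf hnf hq2 htw hNA hsq hqNA hadd hV

end Semistable

/-! ### Kodaira-keyed front-ends: type `Iₙ*` at an odd prime -/

section Istar

variable {W : WeierstrassCurve ℚ} [W.IsElliptic]

/-- **Kodaira type `I₀*` at an odd prime `q`**: the `q*`-twist `Q` of `W` (Kodaira symbol of the model `W` at
the place of `q`, Tate's algorithm — `WeierstrassCurve.kodairaSymbolAt`; for a globally minimal `W` this is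
the curve's Kodaira type) has
GOOD reduction at `q` (`hasGoodReductionAt_quadraticTwist_of_kodairaSymbolAt_eq_Istar_zero`,
Silverman *ATAEC* IV.11.1 table p. 368) and `f_q(W) = 2`; so `ClassAbsManinConstantEqOne Q →
ClassAbsManinConstantEqOne W` (the partner class has conductor `N(W)/q²`). Binder `hnf` only.
[cite: SilvermanATAEC1994, IV.11.1 table p. 368 (I₀*)] [cite: Stevens1989, Lemmas (5.2), (5.4)] -/
theorem classAbsManinConstantEqOne_of_kodairaSymbolAt_eq_Istar_zero
    (hnf : exists_isNewformOf)
    {q : ℕ} (hq : q.Prime) (hq2 : q ≠ 2)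
    (hK : W.kodairaSymbolAt ((primesEquiv (R := ℤ)).symm ⟨q, hq⟩) = .Istar 0)
    (hQ : @ClassAbsManinConstantEqOne (W.quadraticTwist (((-1 : ℤ) ^ (q / 2) * q : ℤ) : ℚ))) :
    ClassAbsManinConstantEqOne W := by
  haveI := Fact.mk hq
  set vq : HeightOneSpectrum ℤ := (primesEquiv (R := ℤ)).symm ⟨q, hq⟩ with hvq
  have hgen : natGenerator vq = q := natGenerator_place'' hq
  have h2 : ringChar (ℤ ⧸ vq.asIdeal) ≠ 2 := by
    rw [Rat.ringChar_int_quotient_asIdeal, hgen]; exact hq2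
  have hgood := W.hasGoodReductionAt_quadraticTwist_of_kodairaSymbolAt_eq_Istar_zero vq h2 hK
    (valuation_pStar'' hq)
  have hf2 : W.conductorExponent vq = 2 :=
    W.conductorExponent_eq_two_of_kodairaSymbolAt vq h2 (Or.inr (Or.inr ⟨0, hK⟩))
  have hsq : q ^ 2 ∣ W.conductorNorm ℤ := by
    rw [hq.pow_dvd_iff_le_factorization (conductorNorm_pos_holds W).ne',
      factorization_conductorNorm_primesEquiv_symm W ⟨q, hq⟩, ← hvq, hf2]
  exact classAbsManinConstantEqOne_of_quadraticTwist_pStar hnf hq hq2 hsq (Or.inl hgood) hQ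

/-- **Kodaira type `I_ν*`, `ν ≥ 1`, at an odd prime `q`**: the `q*`-twist `Q` of `W` is
MULTIPLICATIVE at `q` (`hasMultiplicativeReductionAt_quadraticTwist_pStar_of_kodairaSymbolAt_eq_Istar_succ`)
and `f_q(W) = 2`; so `ClassAbsManinConstantEqOne Q → ClassAbsManinConstantEqOne W` (partner
conductor `N(W)/q`). Binder `hnf` only. [cite: SilvermanATAEC1994, IV.11.1 table p. 368 (I_ν*)]
[cite: Stevens1989, Lemmas (5.2), (5.4)] -/
theorem classAbsManinConstantEqOne_of_kodairaSymbolAt_eq_Istar_succ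
    (hnf : exists_isNewformOf)
    {q : ℕ} (hq : q.Prime) (hq2 : q ≠ 2) {n : ℕ}
    (hK : W.kodairaSymbolAt ((primesEquiv (R := ℤ)).symm ⟨q, hq⟩) = .Istar (n + 1))
    (hQ : @ClassAbsManinConstantEqOne (W.quadraticTwist (((-1 : ℤ) ^ (q / 2) * q : ℤ) : ℚ))) :
    ClassAbsManinConstantEqOne W := by
  set vq : HeightOneSpectrum ℤ := (primesEquiv (R := ℤ)).symm ⟨q, hq⟩ with hvq
  have hgen : natGenerator vq = q := natGenerator_place'' hq
  have h2 : ringChar (ℤ ⧸ vq.asIdeal) ≠ 2 := by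
    rw [Rat.ringChar_int_quotient_asIdeal, hgen]; exact hq2
  have hmult := hasMultiplicativeReductionAt_quadraticTwist_pStar_of_kodairaSymbolAt_eq_Istar_succ
    (W := W) hq hq2 hK
  have hf2 : W.conductorExponent vq = 2 :=
    W.conductorExponent_eq_two_of_kodairaSymbolAt vq h2 (Or.inr (Or.inr ⟨n + 1, hK⟩))
  have hsq : q ^ 2 ∣ W.conductorNorm ℤ := by
    rw [hq.pow_dvd_iff_le_factorization (conductorNorm_pos_holds W).ne',
      factorization_conductorNorm_primesEquiv_symm W ⟨q, hq⟩, ← hvq, hf2]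
  exact classAbsManinConstantEqOne_of_quadraticTwist_pStar hnf hq hq2 hsq (Or.inr hmult) hQ

/-- **Kodaira type `Iₙ*` (any `n ≥ 0`) at an odd prime `q`** — the union of the two previous
theorems: `ClassAbsManinConstantEqOne (W ⊗ χ_{q*}) → ClassAbsManinConstantEqOne W`, binder `hnf`.
[cite: SilvermanATAEC1994, IV.11.1 table p. 368] [cite: Stevens1989, Lemmas (5.2), (5.4)] -/
theorem classAbsManinConstantEqOne_of_kodairaSymbolAt_eq_Istar
    (hnf : exists_isNewformOf)
    {q : ℕ} (hq : q.Prime) (hq2 : q ≠ 2) {n : ℕ}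
    (hK : W.kodairaSymbolAt ((primesEquiv (R := ℤ)).symm ⟨q, hq⟩) = .Istar n)
    (hQ : @ClassAbsManinConstantEqOne (W.quadraticTwist (((-1 : ℤ) ^ (q / 2) * q : ℤ) : ℚ))) :
    ClassAbsManinConstantEqOne W := by
  cases n with
  | zero => exact classAbsManinConstantEqOne_of_kodairaSymbolAt_eq_Istar_zero hnf hq hq2 hK hQ
  | succ n => exact classAbsManinConstantEqOne_of_kodairaSymbolAt_eq_Istar_succ hnf hq hq2 hK hQ

/-- **The same, with the partner's certificate supplied as ONE ROW** — `OptimalCurveManinCertificate V`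
(`ManinConstantClassCertificate.lean`: "`V` is the `Γ₀`-optimal curve of its class and the class
has `|c| = 1`", the shape of a line of Cremona's table or of a two-implementation full-space
modular-symbol certificate at the partner's level, Agashe–Ribet–Stein 2006 appendix §5) for ANY
curve `V` isogenous to the `q*`-twist of `W`: Kodaira type `Iₙ*` at the odd `q` then gives
`ClassAbsManinConstantEqOne W`. Only the row's second component is used (class invariance); the
optimality component locates the row. Binder `hnf` only.
[cite: AgasheRibetStein2006, appendix §5 and Thm. 5.2] [cite: SilvermanATAEC1994, IV.11.1 table p. 368]
[cite: Stevens1989, Lemmas (5.2), (5.4)] -/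
theorem classAbsManinConstantEqOne_of_kodairaSymbolAt_eq_Istar_of_optimalCurveManinCertificate
    (hnf : exists_isNewformOf)
    {q : ℕ} (hq : q.Prime) (hq2 : q ≠ 2) {n : ℕ}
    (hK : W.kodairaSymbolAt ((primesEquiv (R := ℤ)).symm ⟨q, hq⟩) = .Istar n)
    {V : WeierstrassCurve ℚ}
    (hVQ : IsIsogenous V (W.quadraticTwist (((-1 : ℤ) ^ (q / 2) * q : ℤ) : ℚ)))
    (hrow : OptimalCurveManinCertificate V) :
    ClassAbsManinConstantEqOne W :=
  classAbsManinConstantEqOne_of_kodairaSymbolAt_eq_Istar hnf hq hq2 hK (hrow.2.of_isIsogenous hVQ)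

end Istar

/-! ### The level-bounded roads are instances (consistency record) -/

section Instances

variable {W : WeierstrassCurve ℚ} [W.IsElliptic]

/-- The booked road recovered from the transport theorem: Kodaira `Iₙ*` at the odd `q`, the
twist's conductor `≤ 130000`, Agashe–Ribet–Stein 2006 Thm. 2.6 (`h26`) per class
(`classAbsManinConstantEqOne_of_conductorNorm_le`) at the twist — `ClassAbsManinConstantEqOne W`.
(The level clause is put on the twist `W ⊗ χ_{q*}` itself here; the booked certificate puts it on
`N(W)`, which bounds the twist's conductor.) [cite: AgasheRibetStein2006, Thm. 2.6]
[cite: SilvermanATAEC1994, IV.11.1 table p. 368] -/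
theorem classAbsManinConstantEqOne_of_kodairaSymbolAt_eq_Istar_of_conductorNorm_quadraticTwist_le
    (h26 : AgasheRibetStein2006.cremona_abs_maninConstant_eq_one_of_level_le)
    (hnf : exists_isNewformOf)
    {q : ℕ} (hq : q.Prime) (hq2 : q ≠ 2) {n : ℕ}
    (hK : W.kodairaSymbolAt ((primesEquiv (R := ℤ)).symm ⟨q, hq⟩) = .Istar n)
    (hlev : (W.quadraticTwist (((-1 : ℤ) ^ (q / 2) * q : ℤ) : ℚ)).conductorNorm ℤ ≤ 130000) :
    ClassAbsManinConstantEqOne W := by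
  have hd0 : ((((-1 : ℤ) ^ (q / 2) * q : ℤ)) : ℚ) ≠ 0 := by
    push_cast
    exact mul_ne_zero (pow_ne_zero _ (by norm_num)) (by exact_mod_cast hq.ne_zero)
  haveI : (W.quadraticTwist (((-1 : ℤ) ^ (q / 2) * q : ℤ) : ℚ)).IsElliptic :=
    W.isElliptic_quadraticTwist hd0
  exact classAbsManinConstantEqOne_of_kodairaSymbolAt_eq_Istar hnf hq hq2 hK
    (classAbsManinConstantEqOne_of_conductorNorm_le h26 hnf _ hlev)

end Instances

end Literature.NumberTheory.EllipticCurves.ModularForms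

end
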